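import Summits.QuantumAdvantage.QuantumAdvantage.Theses.RandomOracleGauge
import Summits.QuantumAdvantage.QuantumAdvantage.Theorems.SosSandwichTransferPB
import HarnessLib

/-!
# Route `RandomOracleGauge`, crux `PromiseTransfer` (stmt-QuantumAdvantage-10749) — PROVED, from the sibling crux `TransferPB`

The crux `Summit.QuantumAdvantage.QuantumAdvantage.Theses.RandomOracleGauge.PromiseTransfer` (Aaronson–Ambainis 2014,
Thm. 7(iii)/Thm. 23 with `P = P^{#P}` replaced by `PromiseBQP ⊆ PromiseBPP'`: granted the Aaronson–Ambainis conjecture written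
out, `PromiseBQP ⊆ PromiseBPP' → ∀ᵐ A, BQP^A ⊆ AvgP^A`) BY NAME, as a corollary of the sibling crux `TransferPB` of route
`SosSandwich` (`Theorems/SosSandwichTransferPB.lean`, `TransferPB_proof`: the same transfer under the WEAKER influence hypothesis
PB-AA) and the one-line comparison of the hypotheses:

* **`pseudoBoundedAA_of_aaConj`** — the Aaronson–Ambainis conjecture (for all bounded real polynomials of degree `≤ d`:
  `Var ≥ ε ⇒ ∃ i, Inf_i ≥ C (ε/d)^c`) implies PB-AA (the same for pseudo-bounded polynomials of order `T`, with `(ε/T)^c`):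
  a pseudo-bounded `p` of order `T` (`p = Σ q_j²`, `1 − p = Σ r_j²` on the cube, `deg q_j, r_j ≤ T`) has the cube values of
  the genuine polynomial `Σ_j q_j²` of total degree `≤ 2T`, bounded in `[0, 1]` on the cube; apply the conjecture with `d = 2T`
  and absorb `2^c` into the constant;
* **`PromiseTransfer_proof`** — the crux (the conclusions of the two cruxes are reducible respellings of each other:
  `randomOracleMeasure`/`randomOracle`, `Barriers.AvgPRel`/`Complexity.AvgPRel`).

No named fact; axioms standard. Sources: S. Aaronson, A. Ambainis, Theory Comput. 10 (2014) (arXiv:0911.0996), Conj. 6,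
Thm. 7(iii), Thm. 23.
-/

-- D-0017: single-conjunct summit ⇒ the duplicate `QuantumAdvantage.QuantumAdvantage` is mandated.
set_option linter.dupNamespace false

noncomputable section

namespace Summit.QuantumAdvantage.QuantumAdvantage.Theorems.RandomOracleGauge

open Literature.Computability.QuantumComplexity

/-- **The Aaronson–Ambainis conjecture implies PB-AA** (pseudo-bounded Aaronson–Ambainis): a pseudo-bounded polynomial of
order `T` has the cube values of a genuine polynomial of degree `≤ 2T` bounded in `[0,1]` on the cube (`Σ_j q_j²`), so the
conjecture at degree `2T` gives an influential variable with `Inf ≥ C (ε/2T)^c = (C/2^c)(ε/T)^c`.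
[cite: AaronsonAmbainis2014, Conj. 6] -/
theorem pseudoBoundedAA_of_aaConj
    (h : ∃ (c : ℕ) (C : ℝ), 0 < C ∧ ∀ (N d : ℕ) (p : MvPolynomial (Fin N) ℝ) (ε : ℝ), 1 ≤ d → p.totalDegree ≤ d →
      (∀ x, 0 ≤ evalBool p x ∧ evalBool p x ≤ 1) → 0 < ε → ε ≤ boolVariance p → ∃ i : Fin N, C * (ε / d) ^ c ≤ influence i p) :
    Summit.QuantumAdvantage.QuantumAdvantage.Theses.SosSandwich.PseudoBoundedAA := by
  obtain ⟨c, C, hC, h⟩ := h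
  refine ⟨c, C / 2 ^ c, by positivity, ?_⟩
  intro N T p ε
  -- the `let`-bound cube notions of the route file are the tree's `evalBool` / `boolAvg`
  show 1 ≤ T → (∃ (m : ℕ) (q r : Fin m → MvPolynomial (Fin N) ℝ), (∀ j, (q j).totalDegree ≤ T ∧ (r j).totalDegree ≤ T) ∧
      ∀ x : Fin N → Bool, evalBool p x = ∑ j, evalBool (q j) x ^ 2 ∧ 1 - evalBool p x = ∑ j, evalBool (r j) x ^ 2) →
    0 < ε → ε ≤ boolVariance p → ∃ i : Fin N, C / 2 ^ c * (ε / (T : ℝ)) ^ c ≤ influence i p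
  rintro hT ⟨m, q, r, hdeg, hsos⟩ hε hvar
  -- the SOS representative of degree ≤ 2T with the same cube values
  have hev : ∀ x, evalBool (∑ j, q j ^ 2) x = evalBool p x := fun x => by
    rw [(hsos x).1, evalBool, map_sum]
    refine Finset.sum_congr rfl fun j _ => ?_
    rw [map_pow]; rfl
  have hfun : evalBool (∑ j, q j ^ 2) = evalBool p := funext hev
  have hdeg' : (∑ j, q j ^ 2 : MvPolynomial (Fin N) ℝ).totalDegree ≤ 2 * T := by
    refine (MvPolynomial.totalDegree_finsetSum _ _).trans (Finset.sup_le fun j _ => ?_)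
    exact (MvPolynomial.totalDegree_pow _ _).trans (by have := (hdeg j).1; nlinarith)
  have hbd : ∀ x, 0 ≤ evalBool (∑ j, q j ^ 2) x ∧ evalBool (∑ j, q j ^ 2) x ≤ 1 := fun x => by
    rw [hev x]
    refine ⟨?_, ?_⟩
    · rw [(hsos x).1]; exact Finset.sum_nonneg fun j _ => sq_nonneg _
    · have h1 : 0 ≤ 1 - evalBool p x := by rw [(hsos x).2]; exact Finset.sum_nonneg fun j _ => sq_nonneg _
      linarith
  have hvar' : ε ≤ boolVariance (∑ j, q j ^ 2) := by unfold boolVariance; rw [hfun]; exact hvar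
  obtain ⟨i, hi⟩ := h N (2 * T) (∑ j, q j ^ 2) ε (by omega) hdeg' hbd hε hvar'
  refine ⟨i, ?_⟩
  have hinf : influence i (∑ j, q j ^ 2) = influence i p := by unfold influence; rw [hfun]
  rw [hinf] at hi
  have hT0 : (0 : ℝ) < T := by exact_mod_cast hT
  have hcast : ((2 * T : ℕ) : ℝ) = 2 * (T : ℝ) := by push_cast; ring
  rw [hcast] at hi
  have heq : C / 2 ^ c * (ε / (T : ℝ)) ^ c = C * (ε / (2 * (T : ℝ))) ^ c := by
    rw [div_pow, div_pow, mul_pow]; field_simp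
  rw [heq]
  exact hi

/-- **Crux `PromiseTransfer` of route `RandomOracleGauge` (stmt-QuantumAdvantage-10749), BY NAME**: granted the Aaronson–Ambainis
conjecture, if `PromiseBQP ⊆ PromiseBPP'` then `BQP^A ⊆ AvgP^A` for almost every random oracle `A` — the sibling crux
`TransferPB` (route SosSandwich) fed with `pseudoBoundedAA_of_aaConj`; the two conclusions are reducible respellings
(`randomOracleMeasure` ≡ `randomOracle`, `Barriers.AvgPRel` ≡ `Complexity.AvgPRel`). [cite: AaronsonAmbainis2014, Thm. 7(iii) and Thm. 23] -/
theorem PromiseTransfer_proof : Summit.QuantumAdvantage.QuantumAdvantage.Theses.RandomOracleGauge.PromiseTransfer :=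
  fun hAA hPr => Summit.QuantumAdvantage.QuantumAdvantage.Theorems.SosSandwich.TransferPB_proof (pseudoBoundedAA_of_aaConj hAA) hPr

end Summit.QuantumAdvantage.QuantumAdvantage.Theorems.RandomOracleGauge

end
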